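import Literature.MathematicalPhysics.QuantumLattice.ProjectedEntangledPairStates
import HarnessLib

/-!
# PEPS on the square torus — proofs: the single-site block map and its `G`-covariance

Sibling proof file of `Literature/MathematicalPhysics/QuantumLattice/ProjectedEntangledPairStates.lean`
(theorems only; no definition or statement of that file is changed, no definition is introduced).

* `pepsRect_one_one_apply` — the `1 × 1` block map `pepsRect 1 1 A` unfolds to the bilinear map
  `𝒫(A) : X ↦ (σ ↦ Σ_{l u r d} A^{σ(0,0)}_{l u r d} X(l,u,r,d))` (Schuch–Cirac–Pérez-García 2010,
  Def. 2.3), the two families of bond variables of the block splitting into the four legs;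
* `pepsRect_one_one_boundaryAct` — `𝒫(A) ∘ boundaryAct 1 1 U = 𝒫(A)` whenever `legAct Uᴴ` fixes
  every `A^s`: the action `boundaryAct` on boundary tensors (`Ū` on the ket legs, `U` on the bra
  legs) is dual to `legAct` (`U` on kets, `U†` on bras) for the bilinear network pairing;
* `pepsRect_one_one_boundaryAct_of_invariant` — hence for a tensor invariant under a unitary
  representation (`IsGInjectivePEPS` (i)) the block map is invariant under `boundaryAct (U g)` for
  all `g`, which is what makes "left inverse on the `U_g`-invariant subspace" (SCP2010 Def. 5.1
  (ii)) the injectivity of `𝒫(A)` on the fixed space of `boundaryAct`, as recorded in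
  `IsGInjectivePEPS`.

Auxiliary: `sum_fin_one_fun` (sums over `Fin 1 → Fin D`), `sum4_eq_sum_prod` (flattening).

## References

* N. Schuch, I. Cirac, D. Pérez-García, *PEPS as ground states: degeneracy and topology*,
  Ann. Phys. 325 (2010) 2153, arXiv:1001.3807: Def. 2.3 (`𝒫(A)`), Def. 5.1, Lemma 5.2.
  [SchuchCiracPerezGarcia2010]
-/

noncomputable section

open Matrix Complex Finset

namespace Literature.MathematicalPhysics.QuantumLattice

section QLattice

variable {q D : ℕ}

/-- **The single-site block map is `𝒫(A)`**: for a `1 × 1` block,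
`pepsRect 1 1 A X σ = Σ_{l r u d} A^{σ(0,0)}_{l₀ u₀ r₀ d₀} X(l, u, r, d)` (legs as functions on `Fin 1`;
the two bond-variable families split into the left/right and up/down legs), i.e. the bilinear map
`𝒫(A) : X ↦ Σ_s ⟨A^s, X⟩ |s⟩` of Schuch–Cirac–Pérez-García (2010), Def. 2.3.
[cite: SchuchCiracPerezGarcia2010, Def. 2.3] -/
theorem pepsRect_one_one_apply (A : PEPSTensor q D) (X : PEPSBoundary D 1 1)
    (σ : TensorIndex (Fin 1 × Fin 1) q) :
    pepsRect 1 1 A X σ =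
      ∑ l : Fin 1 → Fin D, ∑ r : Fin 1 → Fin D, ∑ u : Fin 1 → Fin D, ∑ d : Fin 1 → Fin D,
        A (σ (0, 0)) (l 0) (u 0) (r 0) (d 0) * X l u r d := by
  -- rows: `(Fin 2 × Fin 1 → Fin D) ≃ (Fin 1 → Fin D) × (Fin 1 → Fin D)`, `η ↦ (η (0, ·), η (1, ·))`
  let eR : (Fin 2 × Fin 1 → Fin D) ≃ (Fin 1 → Fin D) × (Fin 1 → Fin D) :=
    (Equiv.curry (Fin 2) (Fin 1) (Fin D)).trans (piFinTwoEquiv fun _ => Fin 1 → Fin D)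
  -- columns: `(Fin 1 × Fin 2 → Fin D) ≃ (Fin 1 → Fin D) × (Fin 1 → Fin D)`, `ν ↦ (ν (·, 0), ν (·, 1))`
  let eC : (Fin 1 × Fin 2 → Fin D) ≃ (Fin 1 → Fin D) × (Fin 1 → Fin D) :=
    ((Equiv.prodComm (Fin 2) (Fin 1)).arrowCongr (Equiv.refl (Fin D))).symm.trans eR
  simp only [pepsRect, pepsRectWeight]
  rw [← eR.symm.sum_comp]
  simp only [Fintype.sum_prod_type]
  refine sum_congr rfl fun l _ => sum_congr rfl fun r _ => ?_
  rw [← eC.symm.sum_comp]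
  simp only [Fintype.sum_prod_type]
  refine sum_congr rfl fun u _ => sum_congr rfl fun d _ => ?_
  rw [Fintype.prod_subsingleton _ ((0 : Fin 1), (0 : Fin 1))]
  rfl

/-- Sums over `Fin 1 → Fin D` are sums over `Fin D` (constant functions). [folklore] -/
theorem sum_fin_one_fun {M : Type*} [AddCommMonoid M] (G : (Fin 1 → Fin D) → M) :
    ∑ l : Fin 1 → Fin D, G l = ∑ x : Fin D, G (fun _ => x) := by
  refine Fintype.sum_equiv (Equiv.funUnique (Fin 1) (Fin D)) _ _ fun l => ?_
  congr 1
  funext i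
  rw [Subsingleton.elim i default]
  rfl

/-- A fourfold sum over `Fin D` as a single sum over quadruples. [folklore] -/
theorem sum4_eq_sum_prod (F : Fin D → Fin D → Fin D → Fin D → ℂ) :
    ∑ a, ∑ b, ∑ c, ∑ d, F a b c d =
      ∑ v : Fin D × Fin D × Fin D × Fin D, F v.1 v.2.1 v.2.2.1 v.2.2.2 := by
  simp only [Fintype.sum_prod_type]

/-- **Invariance of the single-site block map under the dual boundary action**: if `A` is invariant
under `legAct Uᴴ` (for a unitary representation: under `U_{g⁻¹}`), then
`𝒫(A) ∘ boundaryAct 1 1 U = 𝒫(A)` — the transpose of `boundaryAct 1 1 U` with respect to the bilinear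
pairing `⟨A^s, X⟩` is `legAct Uᴴ`. This is the computation behind reading Schuch–Cirac–Pérez-García's
Def. 5.1 (ii) ("`𝒫(A)⁻¹𝒫(A) = Π_𝒰`, the projector on the `U_g`-invariant subspace") as injectivity of
`𝒫(A)` on the fixed space of `boundaryAct` (`IsGInjectivePEPS`): by this lemma and (i),
`𝒫(A) = 𝒫(A) ∘ boundaryAct (U g)` for every `g`, so `𝒫(A)` factors through the averaging projector
onto that fixed space. No unitarity is needed for the identity itself.
[cite: SchuchCiracPerezGarcia2010, Def. 5.1 and Lemma 5.2] -/
theorem pepsRect_one_one_boundaryAct (U : Matrix (Fin D) (Fin D) ℂ) {A : PEPSTensor q D}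
    (hA : ∀ s, legAct Uᴴ (A s) = A s) (X : PEPSBoundary D 1 1) :
    pepsRect 1 1 A (boundaryAct 1 1 U X) = pepsRect 1 1 A X := by
  funext σ
  rw [pepsRect_one_one_apply, pepsRect_one_one_apply]
  simp only [boundaryAct, Fin.prod_univ_one, sum_fin_one_fun]
  set s := σ (0, 0) with hs
  -- the invariance, in the index order `l r u d` of `pepsRect_one_one_apply`
  have key : ∀ l' u' r' d' : Fin D,
      ∑ l, ∑ r, ∑ u, ∑ d, A s l u r d * (star (U l l') * star (U u u') * U r r' * U d d') =
        A s l' u' r' d' := by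
    intro l' u' r' d'
    have h' := congrFun (congrFun (congrFun (congrFun (hA s) l') u') r') d'
    simp only [legAct, conjTranspose_apply, star_star] at h'
    rw [← h']
    refine Finset.sum_congr rfl fun l _ => ?_
    rw [Finset.sum_comm]
    refine Finset.sum_congr rfl fun u _ => Finset.sum_congr rfl fun r _ =>
      Finset.sum_congr rfl fun d _ => ?_
    ring
  -- flatten the two index blocks
  have flat : ∀ F : Fin D → Fin D → Fin D → Fin D → ℂ,
      ∑ a, ∑ b, ∑ c, ∑ d, F a b c d =
        ∑ v : Fin D × Fin D × Fin D × Fin D, F v.1 v.2.1 v.2.2.1 v.2.2.2 := fun F => by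
    simp only [Fintype.sum_prod_type]
  -- abbreviations
  set xv : Fin D × Fin D × Fin D × Fin D → ℂ :=
    fun w => X (fun _ => w.1) (fun _ => w.2.1) (fun _ => w.2.2.1) (fun _ => w.2.2.2) with hxv
  set ρ : Fin D × Fin D × Fin D × Fin D → Fin D × Fin D × Fin D × Fin D → ℂ :=
    fun v w => star (U v.1 w.1) * star (U v.2.2.1 w.2.1) * U v.2.1 w.2.2.1 * U v.2.2.2 w.2.2.2 with hρ
  set av : Fin D × Fin D × Fin D × Fin D → ℂ := fun v => A s v.1 v.2.2.1 v.2.1 v.2.2.2 with hav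
  -- LHS as a double flat sum
  have hL : (∑ l, ∑ r, ∑ u, ∑ d, A s l u r d *
      ∑ l', ∑ u', ∑ r', ∑ d', star (U l l') * star (U u u') * U r r' * U d d' *
        X (fun _ => l') (fun _ => u') (fun _ => r') (fun _ => d')) =
      ∑ v, ∑ w, av v * (ρ v w * xv w) := by
    rw [flat]
    refine Finset.sum_congr rfl fun v _ => ?_
    rw [flat, Finset.mul_sum]
  -- RHS as a flat sum
  have hR : (∑ l', ∑ r', ∑ u', ∑ d', A s l' u' r' d' *
      X (fun _ => l') (fun _ => u') (fun _ => r') (fun _ => d')) =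
      ∑ w : Fin D × Fin D × Fin D × Fin D, A s w.1 w.2.2.1 w.2.1 w.2.2.2 *
        X (fun _ => w.1) (fun _ => w.2.2.1) (fun _ => w.2.1) (fun _ => w.2.2.2) := by
    rw [flat]
  -- key in flat form: `Σ_v av v * ρ v w = A s w.1 w.2.1 w.2.2.1 w.2.2.2` (w in the order l' u' r' d')
  have hkey : ∀ w : Fin D × Fin D × Fin D × Fin D,
      ∑ v, av v * ρ v w = A s w.1 w.2.1 w.2.2.1 w.2.2.2 := by
    intro w
    rw [← key w.1 w.2.1 w.2.2.1 w.2.2.2, flat]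
  rw [hL, hR, Finset.sum_comm]
  -- reindex the RHS by swapping the middle coordinates `w ↦ (w.1, w.2.2.1, w.2.1, w.2.2.2)`
  have hswap : (∑ w : Fin D × Fin D × Fin D × Fin D, A s w.1 w.2.2.1 w.2.1 w.2.2.2 *
        X (fun _ => w.1) (fun _ => w.2.2.1) (fun _ => w.2.1) (fun _ => w.2.2.2)) =
      ∑ w : Fin D × Fin D × Fin D × Fin D, A s w.1 w.2.1 w.2.2.1 w.2.2.2 * xv w := by
    refine Fintype.sum_equiv
      ((Equiv.refl (Fin D)).prodCongr (Equiv.prodAssoc (Fin D) (Fin D) (Fin D) |>.symm.trans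
        ((Equiv.prodComm (Fin D) (Fin D)).prodCongr (Equiv.refl (Fin D))) |>.trans
          (Equiv.prodAssoc (Fin D) (Fin D) (Fin D)))) _ _ fun w => ?_
    rfl
  rw [hswap]
  refine Finset.sum_congr rfl fun w _ => ?_
  rw [← hkey w, Finset.sum_mul]
  refine Finset.sum_congr rfl fun v _ => ?_
  ring

/-- **`𝒫(A) ∘ boundaryAct (U g) = 𝒫(A)` for a `G`-invariant tensor** (condition (i) of
`IsGInjectivePEPS`, i.e. Schuch–Cirac–Pérez-García Def. 5.1 (i)), for every `g ∈ G`: the previous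
lemma with `(U g)ᴴ = U (g⁻¹)` (unitarity). [cite: SchuchCiracPerezGarcia2010, Def. 5.1] -/
theorem pepsRect_one_one_boundaryAct_of_invariant {G : Type*} [Group G]
    (U : G →* Matrix.unitaryGroup (Fin D) ℂ) {A : PEPSTensor q D}
    (hA : ∀ (g : G) (s : Fin q), legAct (U g : Matrix.unitaryGroup (Fin D) ℂ) (A s) = A s)
    (g : G) (X : PEPSBoundary D 1 1) :
    pepsRect 1 1 A (boundaryAct 1 1 (U g : Matrix.unitaryGroup (Fin D) ℂ) X) = pepsRect 1 1 A X := by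
  refine pepsRect_one_one_boundaryAct _ (fun s => ?_) X
  have hinv : ((U g : Matrix.unitaryGroup (Fin D) ℂ) : Matrix (Fin D) (Fin D) ℂ)ᴴ =
      ((U g⁻¹ : Matrix.unitaryGroup (Fin D) ℂ) : Matrix (Fin D) (Fin D) ℂ) := by
    rw [map_inv, ← Matrix.star_eq_conjTranspose]
    rfl
  rw [hinv]
  exact hA g⁻¹ s

end QLattice

end Literature.MathematicalPhysics.QuantumLattice
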